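import Mathlib
import Summits.Ventures.PercRepro2.TypedStarSplit

/-!
# Splitting a per-copy pinned typed count over the typed edges of a part
(blind cell PercRepro2, night-3 g31, 2026-08-30; `proofs/NIGHT3-CERT.md` §40.11)

`TypedStarSplit.typedCount_split` (night-3 g28) splits `typedCount (F ∪ S) z τ K` into the part
configurations on `S` and per-copy pinned counts on `F` — with ONE pin `z` for the three copies.  Here
the same bookkeeping for the PER-COPY pinned count `typedCount3 (F ∪ S) z₁ z₂ z₃ τ K` (three pins):

* `cond_iff3`, `sum_part_eq3` — the unique-witness argument with three pins;
* **`typedCount3_split`**: `typedCount3 (F ∪ S) z₁ z₂ z₃ τ K = Σ_{(a,b,c) typed on S}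
  typedCount3 F (setOn S a z₁) (setOn S b z₂) (setOn S c z₃) τ K`.

The tool for nesting two parts: the table of a core that itself contains a part (§40.3's
`joinTable = partTable (core ∪ Γ′)`, NOT DONE (v)) splits over the inner part's typed configurations
copy by copy.  Own work; standard axioms.
-/

namespace Summit.Ventures.PercRepro2

namespace TypedStar

section Split3

variable {E : Type*} [Fintype E] [DecidableEq E] {R : Type*} [CommRing R]

omit [Fintype E] in
/-- The outer condition (part triples typed on `S`) with the inner per-copy pinned condition is
equivalent to: `(a, b, c)` are the restrictions of `(x, y, w)` and `(x, y, w)` satisfies the per-copy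
pinned condition of `typedCount3 (F ∪ S) z₁ z₂ z₃ τ K`. -/
lemma cond_iff3 {F S : Finset E} (hd : Disjoint F S) (z₁ z₂ z₃ : Config E) (τ : E → ℕ)
    (a b c x y w : Config E) :
    (((SuppOn S a ∧ SuppOn S b ∧ SuppOn S c) ∧ (∀ e ∈ S, openCount a b c e = τ e)) ∧
        ((∀ e, e ∉ F → x e = setOn S a z₁ e ∧ y e = setOn S b z₂ e ∧ w e = setOn S c z₃ e) ∧
          (∀ e ∈ F, openCount x y w e = τ e))) ↔
      ((a = restrictTo S x ∧ b = restrictTo S y ∧ c = restrictTo S w) ∧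
        ((∀ e, e ∉ F ∪ S → x e = z₁ e ∧ y e = z₂ e ∧ w e = z₃ e) ∧
          (∀ e ∈ F ∪ S, openCount x y w e = τ e))) := by
  constructor
  · rintro ⟨⟨⟨ha, hb, hc⟩, hS⟩, hoff, hF⟩
    have hnotF : ∀ e ∈ S, e ∉ F := fun e he hF' => Finset.disjoint_left.mp hd hF' he
    have hxa : ∀ e ∈ S, x e = a e := fun e he => by
      have := (hoff e (hnotF e he)).1; rwa [setOn_of_mem he] at this
    have hyb : ∀ e ∈ S, y e = b e := fun e he => by
      have := (hoff e (hnotF e he)).2.1; rwa [setOn_of_mem he] at this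
    have hwc : ∀ e ∈ S, w e = c e := fun e he => by
      have := (hoff e (hnotF e he)).2.2; rwa [setOn_of_mem he] at this
    refine ⟨⟨eq_restrictTo_of_suppOn ha hxa, eq_restrictTo_of_suppOn hb hyb,
      eq_restrictTo_of_suppOn hc hwc⟩, ?_, ?_⟩
    · intro e he
      have heF : e ∉ F := fun h => he (Finset.mem_union_left _ h)
      have heS : e ∉ S := fun h => he (Finset.mem_union_right _ h)
      have := hoff e heF
      rwa [setOn_of_not_mem heS, setOn_of_not_mem heS, setOn_of_not_mem heS] at this
    · intro e he
      rcases Finset.mem_union.mp he with h | h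
      · exact hF e h
      · have h1 := hS e h
        simp only [openCount, hxa e h, hyb e h, hwc e h]
        simpa only [openCount] using h1
  · rintro ⟨⟨rfl, rfl, rfl⟩, hoff, hFS⟩
    refine ⟨⟨⟨suppOn_restrictTo S x, suppOn_restrictTo S y, suppOn_restrictTo S w⟩, ?_⟩, ?_, ?_⟩
    · intro e he
      rw [openCount_restrictTo he]
      exact hFS e (Finset.mem_union_right _ he)
    · intro e he
      by_cases hS : e ∈ S
      · simp only [setOn_of_mem hS, restrictTo_of_mem hS, and_self]
      · have := hoff e (fun h => (Finset.mem_union.mp h).elim he hS)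
        simpa only [setOn_of_not_mem hS] using this
    · intro e he
      exact hFS e (Finset.mem_union_left _ he)

/-- The unique-witness sum with three pins. -/
lemma sum_part_eq3 {F S : Finset E} (hd : Disjoint F S) (z₁ z₂ z₃ : Config E) (τ : E → ℕ)
    (K : Config E → Config E → Config E → R) (x y w : Config E) :
    (∑ p : Config E × Config E × Config E,
      if ((SuppOn S p.1 ∧ SuppOn S p.2.1 ∧ SuppOn S p.2.2) ∧ (∀ e ∈ S, openCount p.1 p.2.1 p.2.2 e = τ e)) ∧
          ((∀ e, e ∉ F → x e = setOn S p.1 z₁ e ∧ y e = setOn S p.2.1 z₂ e ∧ w e = setOn S p.2.2 z₃ e) ∧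
            (∀ e ∈ F, openCount x y w e = τ e)) then K x y w else 0) =
      if (∀ e, e ∉ F ∪ S → x e = z₁ e ∧ y e = z₂ e ∧ w e = z₃ e) ∧ (∀ e ∈ F ∪ S, openCount x y w e = τ e)
        then K x y w else 0 := by
  rw [Finset.sum_eq_single (restrictTo S x, restrictTo S y, restrictTo S w)]
  · simp only [cond_iff3 hd z₁ z₂ z₃ τ, true_and]
  · intro p _ hp
    rw [if_neg]
    intro hc
    apply hp
    have := (cond_iff3 hd z₁ z₂ z₃ τ p.1 p.2.1 p.2.2 x y w).mp hc
    obtain ⟨⟨h1, h2, h3⟩, _⟩ := this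
    exact Prod.ext h1 (Prod.ext h2 h3)
  · intro h
    exact absurd (Finset.mem_univ _) h

/-- **Splitting a per-copy pinned typed count over the typed edges of a part.** -/
theorem typedCount3_split {F S : Finset E} (hd : Disjoint F S) (z₁ z₂ z₃ : Config E) (τ : E → ℕ)
    (K : Config E → Config E → Config E → R) :
    typedCount3 (F ∪ S) z₁ z₂ z₃ τ K =
      ∑ a : Config E, ∑ b : Config E, ∑ c : Config E,
        if (SuppOn S a ∧ SuppOn S b ∧ SuppOn S c) ∧ (∀ e ∈ S, openCount a b c e = τ e)
          then typedCount3 F (setOn S a z₁) (setOn S b z₂) (setOn S c z₃) τ K else 0 := by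
  have step : ∀ a b c : Config E,
      (if (SuppOn S a ∧ SuppOn S b ∧ SuppOn S c) ∧ (∀ e ∈ S, openCount a b c e = τ e)
        then typedCount3 F (setOn S a z₁) (setOn S b z₂) (setOn S c z₃) τ K else 0) =
      ∑ x : Config E, ∑ y : Config E, ∑ w : Config E,
        (if ((SuppOn S a ∧ SuppOn S b ∧ SuppOn S c) ∧ (∀ e ∈ S, openCount a b c e = τ e)) ∧
            ((∀ e, e ∉ F → x e = setOn S a z₁ e ∧ y e = setOn S b z₂ e ∧ w e = setOn S c z₃ e) ∧
              (∀ e ∈ F, openCount x y w e = τ e)) then K x y w else 0) := by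
    intro a b c
    unfold typedCount3
    by_cases h : (SuppOn S a ∧ SuppOn S b ∧ SuppOn S c) ∧ (∀ e ∈ S, openCount a b c e = τ e)
    · rw [if_pos h]
      refine Finset.sum_congr rfl fun x _ => Finset.sum_congr rfl fun y _ => Finset.sum_congr rfl fun w _ => ?_
      exact (if_congr (and_iff_right h) rfl rfl).symm
    · rw [if_neg h]
      symm
      refine Finset.sum_eq_zero fun x _ => Finset.sum_eq_zero fun y _ => Finset.sum_eq_zero fun w _ => ?_
      exact if_neg (fun hc => h hc.1)
  rw [Finset.sum_congr rfl (fun a _ => Finset.sum_congr rfl (fun b _ =>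
    Finset.sum_congr rfl (fun c _ => step a b c)))]
  rw [flatten3, sum_comm_out]
  unfold typedCount3
  refine Finset.sum_congr rfl fun x _ => Finset.sum_congr rfl fun y _ => Finset.sum_congr rfl fun w _ => ?_
  exact (sum_part_eq3 hd z₁ z₂ z₃ τ K x y w).symm

end Split3

end TypedStar

end Summit.Ventures.PercRepro2
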